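import Summits.AtomisticToContinuum.HydrodynamicLimit.Theses.MirrorJeffreys
import Literature.MathematicalPhysics.KineticTheory.HardSphereEulerProofs
import HarnessLib

/-!
# Birth skeleton (BC3) for crux `BackwardMeanHydro` — route MirrorJeffreys, item stmt-AtomisticToContinuum-17768

Line `birth` = the route's own foreseen glued split (G1 of the TWO-LAYER PLAN in the route header):
`BackwardMeanHydro ⇐ ForwardGeneralData → EulerReversalContinuation → MirrorDictionary`, typed.

`BackwardMeanHydro` (crux #3) asks: under the crux prefix (`∃ η₀` outermost, profiles, `∃ σ₀`, `σ < σ₀`,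
a packing-guarded classical hs-Euler solution `P = (ρ,u,θ)` on `[0,T)`, flows `Φ`, local Gibbs data with
LLN at `0`), for every `t ∈ [0,T)` and every activity profile `a` whose local Gibbs law
`ψ_t = LG(a, u_t, θ_t)` has the Euler fields `P_t` (LLN at time `0`), the EXPECTED tilt statistics of
`ψ_t` transported by `Φ_(−s)`, `s ∈ [0,t]`, converge to their Euler values at `P_(t−s)`.
The MOVE of the card (velocity reversal `R = flipVel`): `R_# LG(a,u,θ) = LG(a,−u,θ)`,
`Φ_(−s) = R ∘ Φ_s ∘ R` Liouville-a.e., `⟨ξ, F(R z)⟩ = ⟨R̂ξ, F(z)⟩`, and compressible Euler is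
covariant under `(t,u) ↦ (−t,−u)` with the SAME density (hence the same packing guard). So the crux is
FORWARD mean hydrodynamics of the mirrored target `LG(a, −u_t, θ_t)` along the reversed classical
solution `s ↦ R̂P_(t−s)`, up to and including the CLOSED endpoint `s = t`. Three stubs:

* `stub_forwardMeanHydroUniform` (F⁺, load-bearing, open-problem) — FORWARD HYDRODYNAMICS IN THE MEAN,
  IN THE DILUTE BAND, WITH DATA-UNIFORM THRESHOLDS: the sibling crux `ForwardMeanHydro` (stmt-17767)
  with `∃ σ₀` moved BEFORE the profiles (`∃ η₀ ∃ σ₀ ∀ data`). Uniformity is forced by the quantifier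
  order of the crux: `σ₀` is fixed from `(a₀,θ₀,u₀)` before `t` and the target activity `a` are known,
  and F is applied to the data `(a, −u_t, θ_t)`; the route header's "ForwardGeneralData = ForwardMeanHydro
  with η₀, σ₀ uniform over a family of profiles". With the packing guard `ρ_t σ³ < η₀` in the hypothesis
  the profile-dependence of `σ₀` has no remaining role (the laws are probability measures for every
  `σ ≤ 1/2`, `isProbabilityMeasure_localGibbsLaw`), so F⁺ is ForwardMeanHydro in kind; it is strictly
  stronger as typed (F⁺ ⇒ 17767 by `fun h => …⟨σ₀,…⟩`, recorded, intended: crux #3 carries `[deps: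
  ForwardMeanHydro]` in the route).
* `stub_eulerMirrorContinuation` (E, PDE, M/L) — TIME REVERSAL + BACKWARD CONTINUATION OF GUARDED
  CLASSICAL hs-EULER SOLUTIONS: there is a band `η ≤ η₁` in which every packing-guarded classical
  solution on `[0,T)` and every `t < T` admit `T' > t` and a packing-guarded classical solution
  `(ρ',u',θ')` on `[0,T')` with `(ρ',u',θ')(s) = (ρ, −u, θ)(t−s)` on `[0,t]` (reversal covariance of
  `IsHardSphereEulerSolution`; local well-posedness from the smooth data `(ρ₀,−u₀,θ₀)` at `s = t`,
  Kato1975 / Majda1984 Thm 2.1, which needs the virial equation of state `hsPressure` smooth in the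
  band — Lebowitz–Penrose / Ruelle1969 §3.4, the Literature fact HsEosLowDensity; `C^∞` gluing of the
  two one-sided pieces at `s = t` by matching Taylor jets through the equation; guard margin past `t`
  from `max_x ρ₀σ³ < η` on the compact torus).
* `stub_mirrorDictionary` (D, provable-now, M) — THE LAW-LEVEL REVERSAL DICTIONARY, two clauses:
  (D2) the LLN `TendstoHydroFieldsAt … 0` of `LG(a,w,ϑ)` towards fields `(ρ₁,u₁,θ₁)(0)` transfers to
  `LG(a,−w,ϑ)` towards any fields equal to `(ρ₁,−u₁,θ₁)(0)` at time `0`; (D3) for every `N`, flow, `s`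
  and tilt, `E_{LG(a,w,ϑ)}[⟨(lρ,lm,le), F(Φ_(−s) z)⟩] = E_{LG(a,−w,ϑ)}[⟨(lρ,−lm,le), F(Φ_s z)⟩]`
  (no integrability needed: `R` is a measurable involution). Inputs in the tree: `flow_flipVel_ae` /
  `ae_flow_flipVel_localGibbsLaw`, `tiltStatistic_flipVel`, `measurePreserving_flipVel_liouville`, and
  the pushforward identity `R_# LG(a,w,ϑ) = LG(a,−w,ϑ)` (as in `measurePreserving_flipVel_localGibbsLaw`,
  which is its `w = 0` case; `localMaxwellian 1 ϑ w v` depends on `‖v − w‖` only).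

ASSEMBLY `BackwardMeanHydro_of : F⁺ → E → D → BackwardMeanHydro` (sorry-free): `η₀ := min η_F η_E`,
`σ₀ := min σ_F (1/2)`; given the crux data, E reverses-and-continues `P` from `t`; the mirrored target
`(a, −u_t, θ_t)` is continuous/positive (smooth slices of the solution) and its laws are probability
measures (`σ ≤ 1/2`); D2 turns the crux's LLN hypothesis on `ψ_t` into the LLN of the mirrored law
towards the reversed solution at `s = 0`; F⁺ applied to that datum, the reversed solution on `[0,T')`,
`s ∈ [0,t] ⊂ [0,T')` and the tilt `(lρ, −lm, le)` gives the mirrored mean limit; its Euler value is the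
crux's (`⟪−lm, −u⟫ = ⟪lm, u⟫`, `E(ρ,−u,θ) = E(ρ,u,θ)`), and D3 identifies the two expectation
sequences term by term. `BackwardMeanHydro_of_stubs : BackwardMeanHydro` is the hypothesis-free
composition (inherits the three `sorry`s, states nothing new).

Hardest stub: `stub_forwardMeanHydroUniform` (the conjunct's closure content in the mean; the crux's own
"why it might fail"). Disproof used: none — `ledger crux ls stmt-AtomisticToContinuum-17768`: no
workfiles, no `Disproof.lean` at registration. Negatives index (20 entries, 2026-08-17): the only entry
with the prefix shape of E, StrongClosureWeakBV.GeneralStrongClosure (stmt-9395, refuted-misstated through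
a non-measurable Euler datum at an empty horizon), quantifies over particle laws; E is a statement about
classical Euler solutions only and is vacuous at `T ≤ 0`; no entry concerns velocity reversal or
data-uniform thresholds. BC3 probes (`stub → BackwardMeanHydro`, `stub → _root_.HydrodynamicLimit` by
`first | exact? | simpa | aesop`) fail for all three stubs (planner folder `bc/`, record in `birth.md`).
Sources: Spohn1991 Part I §3.2; CIPDiluteGases1994 §4.2 (2.3); Kato1975; Majda1984 Thm 2.1;
EvansSearlesWilliams2016 Ch. 3; BertiniEtAl2015 §II.C; Ruelle1969 §3.4.
-/

namespace Summit.AtomisticToContinuum.HydrodynamicLimit.Cruxes.BackwardMeanHydro.Birth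

open scoped BigOperators Topology Classical MeasureTheory ProbabilityTheory InnerProductSpace
open Filter Set Function TopologicalSpace MeasureTheory
open Literature.MathematicalPhysics.KineticTheory Literature.Analysis.FluidPDE

/-- Registered stub F⁺ — FORWARD MEAN HYDRODYNAMICS IN THE DILUTE BAND WITH DATA-UNIFORM
THRESHOLDS — `∃ η₀ > 0 ∃ σ₀ > 0 ∀` continuous positive profiles `(a₀,θ₀,u₀)` `∀ 0 < σ < σ₀ ∀` classical
hs-Euler solutions on `[0,T)` with `ρ_t(x)σ³ < η₀`, `∀` flows, if the local Gibbs laws are probability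
measures whose fields converge at `t = 0`, then for every `t ∈ [0,T)` and every continuous tilt the
EXPECTED tilt statistic at `Φ_t` converges to its Euler value. (= crux `ForwardMeanHydro`, stmt-17767,
with `∃ σ₀` before the profiles.) Why plausibly true: exactly as plausible as ForwardMeanHydro — the
guard, not `σ₀(profiles)`, is the diluteness condition. Why it might fail: the conjunct's closure content
in the mean (Euler-order anomaly of the mean momentum/heat flux of deterministic spheres; free flight
fails it). Size: open-problem. -/
theorem stub_forwardMeanHydroUniform : ∃ η₀ : ℝ, 0 < η₀ ∧ ∃ σ₀ : ℝ, 0 < σ₀ ∧ ∀ (a₀ θ₀ : Literature.MathematicalPhysics.KineticTheory.T3 → ℝ) (u₀ : Literature.MathematicalPhysics.KineticTheory.T3 → Literature.MathematicalPhysics.KineticTheory.V3), Continuous a₀ → Continuous θ₀ → Continuous u₀ → (∀ x, 0 < a₀ x) → (∀ x, 0 < θ₀ x) → ∀ σ : ℝ, 0 < σ → σ < σ₀ → ∀ (T : ℝ) (ρ θ : ℝ → Literature.MathematicalPhysics.KineticTheory.T3 → ℝ) (u : ℝ → Literature.MathematicalPhysics.KineticTheory.T3 → Literature.MathematicalPhysics.KineticTheory.V3),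 Literature.MathematicalPhysics.KineticTheory.IsHardSphereEulerSolution σ T ρ u θ → (∀ t ∈ Set.Ico 0 T, ∀ x, ρ t x * σ ^ 3 < η₀) → ∀ Φ : (N : ℕ) → Literature.Analysis.FluidPDE.HardSphereFlow (Literature.Analysis.FluidPDE.Torus.geometry (Fin 3)) (Literature.MathematicalPhysics.KineticTheory.hsDiameter σ N) (N + 1), (∀ N, MeasureTheory.IsProbabilityMeasure (Literature.MathematicalPhysics.KineticTheory.localGibbsLaw σ a₀ u₀ θ₀ N (Φ N))) → Literature.MathematicalPhysics.KineticTheory.TendstoHydroFieldsAt (fun N => Literature.MathematicalPhysics.KineticTheory.localGibbsLaw σ a₀ u₀ θ₀ N (Φ N)) Φ ρ u θ 0 → ∀ t ∈ Set.Ico 0 T, ∀ (lρ le : Literature.MathematicalPhysics.KineticTheory.T3 → ℝ) (lm : Literature.MathematicalPhysics.KineticTheory.T3 → Literature.MathematicalPhysics.KineticTheory.V3), Continuous lρ → Continuous le → Continuous lm → Filter.Tendsto (fun N : ℕ => ∫ z, (∫ y, (lρ y.1 + @inner ℝ _ _ (lm y.1) y.2 + le y.1 * (‖y.2‖ ^ 2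 / 2)) ∂Literature.Analysis.FluidPDE.empiricalMeasure ((Φ N).flow t z)) ∂(Literature.MathematicalPhysics.KineticTheory.localGibbsLaw σ a₀ u₀ θ₀ N (Φ N))) Filter.atTop (nhds (∫ x, (lρ x * ρ t x + ρ t x * @inner ℝ _ _ (lm x) (u t x) + le x * Literature.MathematicalPhysics.KineticTheory.totalEnergyDensity (ρ t x) (u t x) (θ t x)))) := by
  sorry

/-- Registered stub E — TIME REVERSAL + BACKWARD CONTINUATION OF PACKING-GUARDED CLASSICAL
hs-EULER SOLUTIONS — there is `η₁ > 0` such that for every band `0 < η ≤ η₁`, every `σ > 0`, every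
classical solution `(ρ,u,θ)` on `[0,T)` with `ρ_t(x)σ³ < η` and every `t ∈ [0,T)` there are `T' > t`
and a classical solution `(ρ',u',θ')` on `[0,T')` with `ρ'_s(x)σ³ < η` on `[0,T')` and
`(ρ',u',θ')(s,x) = (ρ, −u, θ)(t−s, x)` for `s ∈ [0,t]`. Why plausibly true: compressible Euler with
the hard-sphere equation of state is covariant under `(t,u) ↦ (−t,−u)` (mass/energy fluxes odd,
momentum flux and pressure even); the reversed piece is classical on `[0,t]` up to the closed endpoint
(the given solution is smooth on `[0,T)` from the right at `0`); Kato1975 / Majda1984 Thm 2.1 continue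
it from the smooth positive data `(ρ₀,−u₀,θ₀)` for a short time, with `C^∞` gluing through the
equation, once `hsPressure σ ρ θ = ρθ Z(ρσ³)` is smooth for `ρσ³ ≤ η₁` (virial analyticity at low
density, Ruelle1969 §3.4 / HsEosLowDensity); the guard persists past `t` by continuity from
`max_x ρ₀(x)σ³ < η`. Why it might fail: only through the typed equation of state (`hsCompressibility`
via `limsup`/`deriv`) not being smooth on `[0, η₁]` — the low-density virial theorem says it is.
Size: M (mathematics) / L (Lean: no Kato theory in Mathlib). Vacuous for `T ≤ 0`. -/
theorem stub_eulerMirrorContinuation : ∃ η₁ : ℝ, 0 < η₁ ∧ ∀ η : ℝ, 0 < η → η ≤ η₁ → ∀ (σ T : ℝ) (ρ θ : ℝ → Literature.MathematicalPhysics.KineticTheory.T3 → ℝ) (u : ℝ → Literature.MathematicalPhysics.KineticTheory.T3 → Literature.MathematicalPhysics.KineticTheory.V3), 0 < σ → Literature.MathematicalPhysics.KineticTheory.IsHardSphereEulerSolution σ T ρ u θ → (∀ t ∈ Set.Ico 0 T, ∀ x, ρ t x * σ ^ 3 < η) → ∀ t ∈ Set.Ico 0 T, ∃ T' : ℝ,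 t < T' ∧ ∃ (ρ' θ' : ℝ → Literature.MathematicalPhysics.KineticTheory.T3 → ℝ) (u' : ℝ → Literature.MathematicalPhysics.KineticTheory.T3 → Literature.MathematicalPhysics.KineticTheory.V3), Literature.MathematicalPhysics.KineticTheory.IsHardSphereEulerSolution σ T' ρ' u' θ' ∧ (∀ s ∈ Set.Ico 0 T', ∀ x, ρ' s x * σ ^ 3 < η) ∧ ∀ s ∈ Set.Icc 0 t, ∀ x, ρ' s x = ρ (t - s) x ∧ u' s x = -u (t - s) x ∧ θ' s x = θ (t - s) x := by
  sorry

/-- Registered stub D — THE LAW-LEVEL MIRROR DICTIONARY for local Gibbs laws, hard-sphere flows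
and tilt statistics (velocity reversal `R = flipVel`, `R_# LG(a,w,ϑ) = LG(a,−w,ϑ)`,
`Φ_s ∘ R = R ∘ Φ_(−s)` Liouville-a.e., `⟨ξ,F(Rz)⟩ = ⟨R̂ξ,F(z)⟩`), as the two consequences the line
uses: (D2) the law of large numbers of the fields at time `0` under `LG(a,w,ϑ)` towards `(ρ₁,u₁,θ₁)(0)`
transfers to `LG(a,−w,ϑ)` towards any `(ρ₂,u₂,θ₂)` with `(ρ₂,u₂,θ₂)(0) = (ρ₁,−u₁,θ₁)(0)` (density
and energy fields are `R`-even, the momentum field `R`-odd, `Φ_0 = id` a.e.); (D3) for every `N`,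
flow, `s` and tilt `(lρ,lm,le)`, the expectation under `LG(a,w,ϑ)` of the tilt statistic at `Φ_(−s) z`
equals the expectation under `LG(a,−w,ϑ)` of the `(lρ,−lm,le)`-statistic at `Φ_s z` (change of
variables under the measurable involution `R`; no integrability hypothesis). Why plausibly true: it is
true — `localMaxwellian 1 ϑ w v` depends on `‖v − w‖` only and the hard-sphere domain does not see
velocities (cf. `measurePreserving_flipVel_localGibbsLaw`, the `w = 0` case), `ae_flow_flipVel_localGibbsLaw`,
`tiltStatistic_flipVel`. Size: M (provable now). -/
theorem stub_mirrorDictionary : (∀ (σ : ℝ) (a ϑ : Literature.MathematicalPhysics.KineticTheory.T3 → ℝ) (w : Literature.MathematicalPhysics.KineticTheory.T3 → Literature.MathematicalPhysics.KineticTheory.V3) (Φ : (N : ℕ) → Literature.Analysis.FluidPDE.HardSphereFlow (Literature.Analysis.FluidPDE.Torus.geometry (Fin 3)) (Literature.MathematicalPhysics.KineticTheory.hsDiameter σ N) (N + 1)) (ρ₁ θ₁ : ℝ → Literature.MathematicalPhysics.KineticTheory.T3 → ℝ) (u₁ : ℝ → Literature.MathematicalPhysics.KineticTheory.T3 → Literature.MathematicalPhysics.KineticTheory.V3)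 (ρ₂ θ₂ : ℝ → Literature.MathematicalPhysics.KineticTheory.T3 → ℝ) (u₂ : ℝ → Literature.MathematicalPhysics.KineticTheory.T3 → Literature.MathematicalPhysics.KineticTheory.V3), (∀ x, ρ₂ 0 x = ρ₁ 0 x) → (∀ x, u₂ 0 x = -u₁ 0 x) → (∀ x, θ₂ 0 x = θ₁ 0 x) → Literature.MathematicalPhysics.KineticTheory.TendstoHydroFieldsAt (fun N => Literature.MathematicalPhysics.KineticTheory.localGibbsLaw σ a w ϑ N (Φ N)) Φ ρ₁ u₁ θ₁ 0 → Literature.MathematicalPhysics.KineticTheory.TendstoHydroFieldsAt (fun N => Literature.MathematicalPhysics.KineticTheory.localGibbsLaw σ a (fun x => -w x) ϑ N (Φ N)) Φ ρ₂ u₂ θ₂ 0) ∧ (∀ (σ : ℝ) (a ϑ : Literature.MathematicalPhysics.KineticTheory.T3 → ℝ) (w : Literature.MathematicalPhysics.KineticTheory.T3 → Literature.MathematicalPhysics.KineticTheory.V3) (N : ℕ) (Φ : Literature.Analysis.FluidPDE.HardSphereFlow (Literature.Analysis.FluidPDE.Torus.geometry (Fin 3)) (Literature.MathematicalPhysics.KineticTheory.hsDiameter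 σ N) (N + 1)) (s : ℝ) (lρ le : Literature.MathematicalPhysics.KineticTheory.T3 → ℝ) (lm : Literature.MathematicalPhysics.KineticTheory.T3 → Literature.MathematicalPhysics.KineticTheory.V3), ∫ z, (∫ y, (lρ y.1 + @inner ℝ _ _ (lm y.1) y.2 + le y.1 * (‖y.2‖ ^ 2 / 2)) ∂Literature.Analysis.FluidPDE.empiricalMeasure (Φ.flow (-s) z)) ∂(Literature.MathematicalPhysics.KineticTheory.localGibbsLaw σ a w ϑ N Φ) = ∫ z, (∫ y, (lρ y.1 + @inner ℝ _ _ (-lm y.1) y.2 + le y.1 * (‖y.2‖ ^ 2 / 2)) ∂Literature.Analysis.FluidPDE.empiricalMeasure (Φ.flow s z)) ∂(Literature.MathematicalPhysics.KineticTheory.localGibbsLaw σ a (fun x => -w x) ϑ N Φ)) := by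
  sorry

/-- ASSEMBLY (kernel-checked, NO `sorry`): the three stub statements (verbatim the registered
`stub_*` signatures, as explicit hypotheses) imply the crux `BackwardMeanHydro` BY NAME. Thresholds `η₀ := min η_F η_E`,
`σ₀ := min σ_F (1/2)`; reverse-and-continue the guarded solution from `t` (E); the mirrored target
`(a, −u_t, θ_t)` has continuous positive profiles (smooth slices) and probability laws (`σ ≤ 1/2`); its LLN
at `0` towards the reversed solution is the crux's LLN hypothesis on `ψ_t` through (D2); forward mean
hydrodynamics (F⁺) of that datum at time `s ∈ [0,t] ⊂ [0,T')` with the tilt `(lρ, −lm, le)`; the Euler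
value is the crux's (`(ρ',u',θ')(s) = (ρ,−u,θ)(t−s)`, `⟪−lm,−u⟫ = ⟪lm,u⟫`, `E(ρ,−u,θ) = E(ρ,u,θ)`), and
(D3) identifies the two expectation sequences term by term. -/
theorem BackwardMeanHydro_of :
    (∃ η₀ : ℝ, 0 < η₀ ∧ ∃ σ₀ : ℝ, 0 < σ₀ ∧ ∀ (a₀ θ₀ : Literature.MathematicalPhysics.KineticTheory.T3 → ℝ) (u₀ : Literature.MathematicalPhysics.KineticTheory.T3 → Literature.MathematicalPhysics.KineticTheory.V3), Continuous a₀ → Continuous θ₀ → Continuous u₀ → (∀ x, 0 < a₀ x) → (∀ x, 0 < θ₀ x) → ∀ σ : ℝ, 0 < σ → σ < σ₀ → ∀ (T : ℝ) (ρ θ : ℝ → Literature.MathematicalPhysics.KineticTheory.T3 → ℝ) (u : ℝ → Literature.MathematicalPhysics.KineticTheory.T3 → Literature.MathematicalPhysics.KineticTheory.V3), Literature.MathematicalPhysics.KineticTheory.IsHardSphereEulerSolution σ T ρ u θ → (∀ t ∈ Set.Ico 0 T, ∀ x, ρ t x * σ ^ 3 < η₀) → ∀ Φ : (N : ℕ)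 → Literature.Analysis.FluidPDE.HardSphereFlow (Literature.Analysis.FluidPDE.Torus.geometry (Fin 3)) (Literature.MathematicalPhysics.KineticTheory.hsDiameter σ N) (N + 1), (∀ N, MeasureTheory.IsProbabilityMeasure (Literature.MathematicalPhysics.KineticTheory.localGibbsLaw σ a₀ u₀ θ₀ N (Φ N))) → Literature.MathematicalPhysics.KineticTheory.TendstoHydroFieldsAt (fun N => Literature.MathematicalPhysics.KineticTheory.localGibbsLaw σ a₀ u₀ θ₀ N (Φ N)) Φ ρ u θ 0 → ∀ t ∈ Set.Ico 0 T, ∀ (lρ le : Literature.MathematicalPhysics.KineticTheory.T3 → ℝ) (lm : Literature.MathematicalPhysics.KineticTheory.T3 → Literature.MathematicalPhysics.KineticTheory.V3), Continuous lρ → Continuous le → Continuous lm → Filter.Tendsto (fun N : ℕ => ∫ z, (∫ y, (lρ y.1 + @inner ℝ _ _ (lm y.1) y.2 + le y.1 * (‖y.2‖ ^ 2 / 2)) ∂Literature.Analysis.FluidPDE.empiricalMeasure ((Φ N).flow t z)) ∂(Literature.MathematicalPhysics.KineticTheory.localGibbsLaw σ a₀ u₀ θ₀ N (Φ N))) Filter.atTop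 (nhds (∫ x, (lρ x * ρ t x + ρ t x * @inner ℝ _ _ (lm x) (u t x) + le x * Literature.MathematicalPhysics.KineticTheory.totalEnergyDensity (ρ t x) (u t x) (θ t x))))) →
    (∃ η₁ : ℝ, 0 < η₁ ∧ ∀ η : ℝ, 0 < η → η ≤ η₁ → ∀ (σ T : ℝ) (ρ θ : ℝ → Literature.MathematicalPhysics.KineticTheory.T3 → ℝ) (u : ℝ → Literature.MathematicalPhysics.KineticTheory.T3 → Literature.MathematicalPhysics.KineticTheory.V3), 0 < σ → Literature.MathematicalPhysics.KineticTheory.IsHardSphereEulerSolution σ T ρ u θ → (∀ t ∈ Set.Ico 0 T, ∀ x, ρ t x * σ ^ 3 < η) → ∀ t ∈ Set.Ico 0 T, ∃ T' : ℝ, t < T' ∧ ∃ (ρ' θ' : ℝ → Literature.MathematicalPhysics.KineticTheory.T3 → ℝ) (u' : ℝ → Literature.MathematicalPhysics.KineticTheory.T3 → Literature.MathematicalPhysics.KineticTheory.V3), Literature.MathematicalPhysics.KineticTheory.IsHardSphereEulerSolution σ T' ρ' u' θ' ∧ (∀ s ∈ Set.Ico 0 T', ∀ x, ρ' s x * σ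 ^ 3 < η) ∧ ∀ s ∈ Set.Icc 0 t, ∀ x, ρ' s x = ρ (t - s) x ∧ u' s x = -u (t - s) x ∧ θ' s x = θ (t - s) x) →
    ((∀ (σ : ℝ) (a ϑ : Literature.MathematicalPhysics.KineticTheory.T3 → ℝ) (w : Literature.MathematicalPhysics.KineticTheory.T3 → Literature.MathematicalPhysics.KineticTheory.V3) (Φ : (N : ℕ) → Literature.Analysis.FluidPDE.HardSphereFlow (Literature.Analysis.FluidPDE.Torus.geometry (Fin 3)) (Literature.MathematicalPhysics.KineticTheory.hsDiameter σ N) (N + 1)) (ρ₁ θ₁ : ℝ → Literature.MathematicalPhysics.KineticTheory.T3 → ℝ) (u₁ : ℝ → Literature.MathematicalPhysics.KineticTheory.T3 → Literature.MathematicalPhysics.KineticTheory.V3) (ρ₂ θ₂ : ℝ → Literature.MathematicalPhysics.KineticTheory.T3 → ℝ) (u₂ : ℝ → Literature.MathematicalPhysics.KineticTheory.T3 → Literature.MathematicalPhysics.KineticTheory.V3), (∀ x, ρ₂ 0 x = ρ₁ 0 x) → (∀ x, u₂ 0 x = -u₁ 0 x) → (∀ x, θ₂ 0 x = θ₁ 0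 x) → Literature.MathematicalPhysics.KineticTheory.TendstoHydroFieldsAt (fun N => Literature.MathematicalPhysics.KineticTheory.localGibbsLaw σ a w ϑ N (Φ N)) Φ ρ₁ u₁ θ₁ 0 → Literature.MathematicalPhysics.KineticTheory.TendstoHydroFieldsAt (fun N => Literature.MathematicalPhysics.KineticTheory.localGibbsLaw σ a (fun x => -w x) ϑ N (Φ N)) Φ ρ₂ u₂ θ₂ 0) ∧ (∀ (σ : ℝ) (a ϑ : Literature.MathematicalPhysics.KineticTheory.T3 → ℝ) (w : Literature.MathematicalPhysics.KineticTheory.T3 → Literature.MathematicalPhysics.KineticTheory.V3) (N : ℕ) (Φ : Literature.Analysis.FluidPDE.HardSphereFlow (Literature.Analysis.FluidPDE.Torus.geometry (Fin 3)) (Literature.MathematicalPhysics.KineticTheory.hsDiameter σ N) (N + 1)) (s : ℝ) (lρ le : Literature.MathematicalPhysics.KineticTheory.T3 → ℝ) (lm : Literature.MathematicalPhysics.KineticTheory.T3 → Literature.MathematicalPhysics.KineticTheory.V3), ∫ z, (∫ y, (lρ y.1 + @inner ℝ _ _ (lm y.1) y.2 + le y.1 * (‖y.2‖ ^ 2 /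 2)) ∂Literature.Analysis.FluidPDE.empiricalMeasure (Φ.flow (-s) z)) ∂(Literature.MathematicalPhysics.KineticTheory.localGibbsLaw σ a w ϑ N Φ) = ∫ z, (∫ y, (lρ y.1 + @inner ℝ _ _ (-lm y.1) y.2 + le y.1 * (‖y.2‖ ^ 2 / 2)) ∂Literature.Analysis.FluidPDE.empiricalMeasure (Φ.flow s z)) ∂(Literature.MathematicalPhysics.KineticTheory.localGibbsLaw σ a (fun x => -w x) ϑ N Φ))) →
    Summit.AtomisticToContinuum.HydrodynamicLimit.Theses.MirrorJeffreys.BackwardMeanHydro := by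
  intro hF hE hD
  obtain ⟨ηF, hηF, σF, hσF, HF⟩ := hF
  obtain ⟨ηE, hηE, HE⟩ := hE
  obtain ⟨D2, D3⟩ := hD
  refine ⟨min ηF ηE, lt_min hηF hηE, fun a₀ θ₀ u₀ ha hθ hu ha0 hθ0 => ?_⟩
  refine ⟨min σF (1 / 2), lt_min hσF one_half_pos, ?_⟩
  intro σ hσ hσl T ρ θ u hsol hg Φ hP h0 t ht a hac hap hΨ hlim s hs lρ le lm clρ cle clm
  obtain ⟨hσF', hσ2'⟩ := lt_min_iff.mp hσl
  have hσ2 : σ ≤ 1 / 2 := hσ2'.le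
  -- (E) run the guarded classical solution backwards from `t`: a guarded classical solution on `[0, T')`, `T' > t`
  obtain ⟨T', htT', ρ', θ', u', hsol', hg', hmir⟩ :=
    HE (min ηF ηE) (lt_min hηF hηE) (min_le_right _ _) σ T ρ θ u hσ hsol hg t ht
  -- the mirrored target datum `(a, -u_t, θ_t)`: continuous, positive, probability laws for `σ ≤ 1/2`
  have hut : Continuous (u t) := (hsol.smooth_velocity.isSmooth_slice ht).continuous
  have hθt : Continuous (θ t) := (hsol.smooth_temperature.isSmooth_slice ht).continuous
  have hθp : ∀ x, 0 < θ t x := hsol.temperature_pos t ht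
  have hnu : Continuous fun x => -u t x := hut.neg
  have hΨ' : ∀ N, IsProbabilityMeasure (localGibbsLaw σ a (fun x => -u t x) (θ t) N (Φ N)) := fun N =>
    Literature.MathematicalPhysics.KineticTheory.isProbabilityMeasure_localGibbsLaw hac hθt hnu hap hθp hσ2 N (Φ N)
  -- (D2) the crux's LLN of `ψ_t` at time 0 is the LLN of the mirrored law towards the reversed solution at `s = 0`
  have h0' : TendstoHydroFieldsAt (fun N => localGibbsLaw σ a (fun x => -u t x) (θ t) N (Φ N)) Φ ρ' u' θ' 0 := by
    refine D2 σ a (θ t) (u t) Φ (fun _ => ρ t) (fun _ => θ t) (fun _ => u t) ρ' θ' u' ?_ ?_ ?_ hlim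
    · intro x
      have h := (hmir 0 ⟨le_rfl, ht.1⟩ x).1
      rwa [sub_zero] at h
    · intro x
      have h := (hmir 0 ⟨le_rfl, ht.1⟩ x).2.1
      rwa [sub_zero] at h
    · intro x
      have h := (hmir 0 ⟨le_rfl, ht.1⟩ x).2.2
      rwa [sub_zero] at h
  -- (F⁺) forward mean hydrodynamics of the mirrored target along the reversed solution at `s ∈ [0,t] ⊂ [0,T')`,
  -- with the mirrored tilt `(lρ, -lm, le)`
  have hs' : s ∈ Set.Ico 0 T' := ⟨hs.1, hs.2.trans_lt htT'⟩
  have key : Filter.Tendsto (fun N : ℕ => ∫ z, (∫ y, (lρ y.1 + @inner ℝ _ _ (-lm y.1) y.2 + le y.1 * (‖y.2‖ ^ 2 / 2))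
      ∂Literature.Analysis.FluidPDE.empiricalMeasure ((Φ N).flow s z)) ∂(localGibbsLaw σ a (fun x => -u t x) (θ t) N (Φ N)))
      Filter.atTop (nhds (∫ x, (lρ x * ρ' s x + ρ' s x * @inner ℝ _ _ (-lm x) (u' s x) +
        le x * totalEnergyDensity (ρ' s x) (u' s x) (θ' s x)))) :=
    HF a (θ t) (fun x => -u t x) hac hθt hnu hap hθp σ hσ hσF' T' ρ' θ' u' hsol'
      (fun r hr x => (hg' r hr x).trans_le (min_le_left _ _)) Φ hΨ' h0' s hs' lρ le (fun x => -lm x) clρ cle clm.neg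
  -- the Euler value of the mirrored problem at `s` is the crux's value at `t - s`
  have hval : (∫ x, (lρ x * ρ' s x + ρ' s x * @inner ℝ _ _ (-lm x) (u' s x) +
        le x * totalEnergyDensity (ρ' s x) (u' s x) (θ' s x))) =
      ∫ x, (lρ x * ρ (t - s) x + ρ (t - s) x * @inner ℝ _ _ (lm x) (u (t - s) x) +
        le x * totalEnergyDensity (ρ (t - s) x) (u (t - s) x) (θ (t - s) x)) := by
    refine integral_congr_ae (Filter.Eventually.of_forall fun x => ?_)
    obtain ⟨h1, h2, h3⟩ := hmir s hs x
    simp only [h1, h2, h3, inner_neg_neg, Literature.MathematicalPhysics.KineticTheory.totalEnergyDensity, norm_neg]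
  rw [hval] at key
  -- (D3) the expectation under `ψ_t` at `Φ_(-s)` is the mirrored expectation at `Φ_s`, for every `N`
  exact key.congr fun N => (D3 σ a (θ t) (u t) N (Φ N) s lρ le lm).symm

/-- The crux from the three registered stubs (hypothesis-free composition; type-checks that the three
`stub_*` theorems are literally the hypotheses of `BackwardMeanHydro_of`; inherits the stubs' `sorry`s,
states nothing new). -/
theorem BackwardMeanHydro_of_stubs :
    Summit.AtomisticToContinuum.HydrodynamicLimit.Theses.MirrorJeffreys.BackwardMeanHydro :=
  BackwardMeanHydro_of stub_forwardMeanHydroUniform stub_eulerMirrorContinuation stub_mirrorDictionary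

end Summit.AtomisticToContinuum.HydrodynamicLimit.Cruxes.BackwardMeanHydro.Birth
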